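import Summits.QuantumFields.YangMills.Theorems.BalabanUVNodesN08HaarCompatibilityGuardKStepMassesSU2
import Summits.QuantumFields.YangMills.Theorems.BalabanUVNodesN08HaarCompatibilityGuardCoreLawSU2Record

/-!
# BalabanUVNodes ∕ N08 — THE k-STEP a.e. BOUND ON PRINT'S ITERATED RADON–NIKODYM HISTORY MASSES AT THE SLOT, `N = 2`, (H_K) DISCHARGED, ON THE RECORD RANGE
# `L^{d−1} ≤ 400`: `m_k(h,V) ≤ Π_{j<k} h(δ′)^{−n_j}(h(δ′) + (K−1)·h(1∕3+δ′)^{L^{d−1}−1})^{n_j}` a.e., `K ≤ 3·10⁸` (item 3, part 32: part 28 re-run over part 31)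

WIDTH SEAT `pub-ymgap-dag-n08-w3` g6, item-3 lineage, 2026-08-28.  Part 28 (p629481, g5) gave these letters on `L^{d−1} ≤ 9` (the smallest admissible block size `L = 3`
at `d = 3`) from part 27C; part 31 (`…GuardCoreLawSU2Record`) supplies (H_K) at `N = 2` on `L^{d−1} ≤ 400` from the monotone-height injectivity of part 30C, so the
same two-liners now cover EVERY `L ≤ 20` at `d = 3`, in particular the record's smallest admissible block sizes `8 ≤ θ.L ≤ 20` ([B13] closers,
`CarriersB13.eight_le_c13OfRecord_L_iff`).  DAG node N08 = [Balaban1985UV3] Thm 1 p. 257 + Thm 2 p. 272, (41) p. 266 (the history masses), (5) p. 256; key item K1⁷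
`StabilityBAtRecordR13SepCoPH` (stmt-QuantumFields-20542, `aside`), `--supports … --as helper`.  COUNT-NEUTRAL.

WHAT THIS FILE PROVES (theorems only, 0 def; bookkeeping by name over parts 23, 28's imports and 31):
 ★★ `massRecAC_avOfPrint_le_prod_ae_su2_record` (the k-step a.e. mass bound, `L^{d−1} ≤ 400`, NO (H_K) hypothesis) · ★★ `map_avOfPrint_le_smul_su2_record` (ONE step divided
 through: `Ū_*(dU_j) ≤ D_j • dU_{j+1}`) · ★★ `TOfPrint_one_le_ae_su2_record` (print's own RN version: **`T1 ≤ D_j` a.e.**, n08-w1's density currency) ·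
 ★ `kstar_record_le` (**`K ≤ 3·10⁸`** in the kernel).
HONEST FRAMING: extensive in the FIRST (finest) coarse lattice — the product runs over all levels `j < k` with `n_j = #PBond(j+1)` (stacking); this is NOT the k-UNIFORM
letter `hmass` (`e^{c|T₁^{(k)}|}`, `c` uniform in `k`) that N08's Theorem-1 letter wants (n08-w1's (a)′ ∕ R4⁷–R4⁸ residual; n08-w1 g6's comparison principle
`massRecAC_le_ae_of_supersolution` is the consumer); E6′ NOT decided; count-neutral; N08 NOT discharged; counts unmoved (typed 28∕28 · discharged 5∕27); one finite 𝕋⁴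
programme at fixed ε — R4 closes the CONDITIONAL rung `BalabanLadder.UV` only; the Yang–Mills mass gap (Clay) is NOT proved; nothing continuum ∕ OS.  0 `sorry`,
standard axioms.
-/

noncomputable section

open MeasureTheory Function
open scoped ENNReal

namespace Summit.QuantumFields.YangMills.BalabanUVNodes.N08HaarCompatibilityGuardKStepMassesSU2Record

open Literature.MathematicalPhysics.QuantumFieldTheory.Balaban1983to89
open Summit.QuantumFields.Balaban3D.Carriers
open Summit.QuantumFields.Balaban3D.Proofs.MassesAC
open Literature.MathematicalPhysics.QuantumFieldTheory.Balaban1985CMP102.Setting (Scales)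
open Literature.MathematicalPhysics.QuantumFieldTheory.Balaban1983to89.B10RunsOfRecord (avOfPrint)
open Literature.MathematicalPhysics.QuantumFieldTheory.Balaban1983to89.Node00 (SU)
open Literature.MathematicalPhysics.QuantumFieldTheory.Balaban1983to89.B10RunsOfRecord (TOfPrint)
open Summit.QuantumFields.YangMills.BalabanUVNodes.N08HaarCompatibilityGuardKStepMasses (massRecAC_avOfPrint_le_prod_ae_of_pos map_avOfPrint_le_smul_of_HK
  haar_dist1_lt_ne_zero)
open Summit.QuantumFields.YangMills.BalabanUVNodes.N08OneStepExcessDensity (rnDeriv_map_avOfPrint_ae_eq_TOfPrint_one)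
open Literature.MathematicalPhysics.QuantumFieldTheory.Balaban1983to89.T4LimitDensity (rnDeriv_le_of_le_smul)
open Summit.QuantumFields.YangMills.BalabanUVNodes.N08HaarCompatibilityGuardCoreLawSU2Record (fibre_law_le_su2_record card_not_central_div_le_record
  mstar_record_pos)

variable {L : ℕ} (S : Scales L) (M₁ : ℕ) (Rcol : ℕ → ℕ) (εL εS : ℕ → ℝ)

/-- ★★ **THE k-STEP a.e. MASS BOUND AT THE SLOT, `N = 2`, (H_K) DISCHARGED, RECORD RANGE** (`L^{d−1} ≤ 400`, i.e. every `L ≤ 20` at `d = 3`, the record's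
`8 ≤ θ.L ≤ 20` included): for `dU_k`-a.e. `V`, `m_k(h,V) ≤ Π_{j<k} h(δ′)^{−n_j}(h(δ′) + (K − 1)·h(1∕3 + δ′)^{L^{d−1}−1})^{n_j}` with `K = m⋆⁻¹ + 1` the number of part 31.
Fine-lattice-extensive (stacking), NOT the k-uniform `hmass`. [cite: Balaban1985UV3, (41) p.266 + (5) p.256 + (2) p.256; Balaban1987RG1, (0.4) p.253 (bookkeeping — no bound of print is asserted)] -/
theorem massRecAC_avOfPrint_le_prod_ae_su2_record (hL : S.P.L ^ (S.P.d - 1) ≤ 400) (k : ℕ) (hk : k ≤ S.P.m + S.P.K) {δ' : ℝ} (hδ' : 0 < δ') (h : Hist S.P k) :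
    ∀ᵐ V ∂(fieldMeasure S.P k (SU 2)), massRecAC M₁ Rcol εL εS (avOfPrint 2 S) k h V ≤
      (∏ j ∈ Finset.range k,
        (((HaarData.haar : Measure (SU 2)) {g : SU 2 | dist1 g < δ'} ^ Fintype.card (PBond S.P (j + 1)))⁻¹ *
          ((HaarData.haar : Measure (SU 2)) {g : SU 2 | dist1 g < δ'} +
              (((ENNReal.ofReal (((1 / 400 : ℝ) * Real.sin 1 * (Real.sin (Real.pi / 3) / (Real.pi / 3))) ^ 3 *
                  (Real.sin (Real.pi / 3) / (Real.pi / 3)) ^ 2))⁻¹ + 1) - 1) *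
                (HaarData.haar : Measure (SU 2)) {g : SU 2 | dist1 g < min (1 / 3) (Real.pi / (2 : ℕ)) + δ'} ^ (S.P.L ^ (S.P.d - 1) - 1)) ^
            Fintype.card (PBond S.P (j + 1)))).toReal :=
  massRecAC_avOfPrint_le_prod_ae_of_pos 2 S M₁ Rcol εL εS le_add_self
    (ENNReal.add_ne_top.2 ⟨ENNReal.inv_ne_top.2 (ENNReal.ofReal_pos.2 mstar_record_pos).ne', ENNReal.one_ne_top⟩) k hk
    (fun j hj c U hU => fibre_law_le_su2_record (by omega) (fun c => card_not_central_div_le_record c hL) c U hU) hδ' h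

/-- ★★ **ONE STEP, DIVIDED THROUGH, NO (H_K), RECORD RANGE**: at the slot `N = 2`, `L^{d−1} ≤ 400`, every level `j` with `j+1 ≤ m+K` and every `δ′ > 0`:
`(avOfPrint 2)_{j*}(dU_j) ≤ D_j • dU_{j+1}`, `D_j = h(δ′)^{−n}(h(δ′) + (K − 1)·h(1∕3 + δ′)^{L^{d−1}−1})^{n}`, `n = #PBond(j+1)` (part 23's `map_avOfPrint_le_smul_of_HK` fed with
part 31).
[cite: Balaban1985UV3, (2) p.256; Balaban1987RG1, (0.4) p.253 (bookkeeping — the bound is NOT in print)] -/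
theorem map_avOfPrint_le_smul_su2_record (hL : S.P.L ^ (S.P.d - 1) ≤ 400) {j : ℕ} (hj : j + 1 ≤ S.P.m + S.P.K) {δ' : ℝ} (hδ' : 0 < δ') :
    (fieldMeasure S.P j (SU 2)).map (avOfPrint 2 S j).avg ≤
      (((HaarData.haar : Measure (SU 2)) {g : SU 2 | dist1 g < δ'} ^ Fintype.card (PBond S.P (j + 1)))⁻¹ *
          ((HaarData.haar : Measure (SU 2)) {g : SU 2 | dist1 g < δ'} +
              (((ENNReal.ofReal (((1 / 400 : ℝ) * Real.sin 1 * (Real.sin (Real.pi / 3) / (Real.pi / 3))) ^ 3 *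
                  (Real.sin (Real.pi / 3) / (Real.pi / 3)) ^ 2))⁻¹ + 1) - 1) *
                (HaarData.haar : Measure (SU 2)) {g : SU 2 | dist1 g < min (1 / 3) (Real.pi / (2 : ℕ)) + δ'} ^ (S.P.L ^ (S.P.d - 1) - 1)) ^
            Fintype.card (PBond S.P (j + 1))) •
        fieldMeasure S.P (j + 1) (SU 2) :=
  map_avOfPrint_le_smul_of_HK 2 S hj le_add_self
    (ENNReal.add_ne_top.2 ⟨ENNReal.inv_ne_top.2 (ENNReal.ofReal_pos.2 mstar_record_pos).ne', ENNReal.one_ne_top⟩)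
    (fun c U hU => fibre_law_le_su2_record hj (fun c => card_not_central_div_le_record c hL) c U hU) (haar_dist1_lt_ne_zero 2 hδ')

/-- ★★ **THE ONE-STEP DENSITY IN PRINT'S OWN LETTER: `T1 ≤ D_j` a.e.** (print's Radon–Nikodym version `TOfPrint` of (10) along (15); n08-w1's density currency
`ρ_j = T1` a.e., `…N08OneStepExcessDensity.rnDeriv_map_avOfPrint_ae_eq_TOfPrint_one`) — at the slot `N = 2`, `L^{d−1} ≤ 400` (the record's block sizes), NO (H_K)
hypothesis.
[cite: Balaban1985UV3, (2) p.256; Balaban1985Averaging, (10) p.19 (bookkeeping — no bound of print is asserted)] -/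
theorem TOfPrint_one_le_ae_su2_record (hL : S.P.L ^ (S.P.d - 1) ≤ 400) {j : ℕ} (hj : j + 1 ≤ S.P.m + S.P.K) {δ' : ℝ} (hδ' : 0 < δ') :
    ∀ᵐ V ∂(fieldMeasure S.P (j + 1) (SU 2)), ENNReal.ofReal ((TOfPrint 2 S j).T 1 V) ≤
      ((HaarData.haar : Measure (SU 2)) {g : SU 2 | dist1 g < δ'} ^ Fintype.card (PBond S.P (j + 1)))⁻¹ *
          ((HaarData.haar : Measure (SU 2)) {g : SU 2 | dist1 g < δ'} +
              (((ENNReal.ofReal (((1 / 400 : ℝ) * Real.sin 1 * (Real.sin (Real.pi / 3) / (Real.pi / 3))) ^ 3 *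
                  (Real.sin (Real.pi / 3) / (Real.pi / 3)) ^ 2))⁻¹ + 1) - 1) *
                (HaarData.haar : Measure (SU 2)) {g : SU 2 | dist1 g < min (1 / 3) (Real.pi / (2 : ℕ)) + δ'} ^ (S.P.L ^ (S.P.d - 1) - 1)) ^
            Fintype.card (PBond S.P (j + 1)) := by
  haveI := HaarData.isProb (G := SU 2)
  filter_upwards [rnDeriv_le_of_le_smul (map_avOfPrint_le_smul_su2_record S hL hj hδ'), rnDeriv_map_avOfPrint_ae_eq_TOfPrint_one 2 S j] with V hV hT
  rw [← hT]; exact hV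

/-- ★ **THE CONSTANT IS A NUMBER: `K = m⋆⁻¹ + 1 ≤ 3·10⁸`** at the record range (`sin 1 ≥ 5∕6`, `√3 ≥ 1.732`, `π ≤ 3.1416` give
`m⋆ = ((1∕400) sin 1 q)³q² ≥ 1∕(3·10⁸ − 1)`). [folklore] -/
theorem kstar_record_le : ((ENNReal.ofReal (((1 / 400 : ℝ) * Real.sin 1 * (Real.sin (Real.pi / 3) / (Real.pi / 3))) ^ 3 *
      (Real.sin (Real.pi / 3) / (Real.pi / 3)) ^ 2))⁻¹ + 1 : ℝ≥0∞) ≤ 300000000 := by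
  set q : ℝ := Real.sin (Real.pi / 3) / (Real.pi / 3) with hq_def
  set κ : ℝ := (1 / 400 : ℝ) * Real.sin 1 * q with hκ_def
  have hs1 : (5 / 6 : ℝ) ≤ Real.sin 1 := by
    have := Real.sin_gt_sub_cube (x := 1) one_pos; norm_num at this; linarith
  have hπ : Real.pi < 3.1416 := Real.pi_lt_d4
  have hr3 : (1.732 : ℝ) ≤ Real.sqrt 3 := by
    rw [show (1.732 : ℝ) = Real.sqrt (1.732 ^ 2) from (Real.sqrt_sq (by norm_num)).symm]
    exact Real.sqrt_le_sqrt (by norm_num)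
  have hq : (0.826 : ℝ) ≤ q := by
    rw [hq_def, Real.sin_pi_div_three, le_div_iff₀ (by positivity)]
    nlinarith
  have hκ : (0.00172 : ℝ) ≤ κ := by rw [hκ_def]; nlinarith
  have hm : (1 / 299999999 : ℝ) ≤ κ ^ 3 * q ^ 2 := by
    have h1 : (0.00172 : ℝ) ^ 3 ≤ κ ^ 3 := pow_le_pow_left₀ (by norm_num) hκ 3
    have h2 : (0.826 : ℝ) ^ 2 ≤ q ^ 2 := pow_le_pow_left₀ (by norm_num) hq 2
    calc (1 / 299999999 : ℝ) ≤ (0.00172 : ℝ) ^ 3 * (0.826 : ℝ) ^ 2 := by norm_num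
      _ ≤ κ ^ 3 * q ^ 2 := mul_le_mul h1 h2 (by norm_num) (le_trans (by norm_num) h1)
  have hinv : (ENNReal.ofReal (κ ^ 3 * q ^ 2))⁻¹ ≤ 299999999 := by
    calc (ENNReal.ofReal (κ ^ 3 * q ^ 2))⁻¹ ≤ (ENNReal.ofReal (1 / 299999999 : ℝ))⁻¹ := ENNReal.inv_le_inv.2 (ENNReal.ofReal_le_ofReal hm)
      _ = 299999999 := by
          rw [one_div, ENNReal.ofReal_inv_of_pos (by norm_num), inv_inv]
          norm_num
  calc (ENNReal.ofReal (κ ^ 3 * q ^ 2))⁻¹ + 1 ≤ 299999999 + 1 := add_le_add hinv le_rfl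
    _ = 300000000 := by norm_num

end Summit.QuantumFields.YangMills.BalabanUVNodes.N08HaarCompatibilityGuardKStepMassesSU2Record

end
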